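import Mathlib
import HarnessLib

/-!
# The Gaussian tail bound `P(Z > z) ≤ φ(z)/z` (Mills), hence `N(0,1)([−z, z]) ≥ 1 − 2φ(z)/z`, and
# the number it gives the A-versus-B table: `N(0,1)([−2, 2]) ≥ 0.946`, so seven independent
# columns at the `2σ_comb` level agree simultaneously with asymptotic probability `> 2/3`

HONEST FRAMING: exact (Metropolis-corrected) sampling algorithms for lattice gauge theory;
figures of merit are autocorrelation/cost numbers at stated couplings and volumes; no
continuum-physics claim.

Venture `LatticeQCDFlow` (cell pub-lqcd), topic `Scoring`; FANOUT row 4 (`s0-u1-b`, rung S0-B: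
"A vs B … at every β").  `Scoring/SimultaneousAgreementIndependentColumns` (GEN-29) shows that with
independent couplings the whole table agrees with asymptotic probability `c(z)^k`,
`c(z) = N(0,1)([−z, z])`, and that the `1σ_comb` rule at `k = 7` couplings gives `c(1)⁷ < 0.075`.
This file is the constructive side: a LOWER bound on `c(z)` from the classical tail estimate
`P(Z > z) ≤ φ(z)/z` (`φ` the standard normal density; proved here from
`∫_{(z,∞)} x e^{−x²/2} dx = e^{−z²/2}`, the fundamental theorem of calculus on a half-line, and
`φ(x) ≤ (x/z) φ(x)` on `(z, ∞)`), giving **`gaussianReal_real_Icc_ge`**: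
`c(z) ≥ 1 − 2φ(z)/z` for `z > 0`.  At `z = 2`: `φ(2) = e^{−2}/√(2π) < 0.0541` (`e > 2.718`,
`π > 3.1415`), so `c(2) ≥ 0.9459` (**`gaussianReal_real_Icc_two_ge`**; true value `≈ 0.9545`) and
`c(2)⁷ > 2/3` (**`gaussianReal_real_Icc_two_pow_seven_gt`**; true value `≈ 0.722`): read with the
product law, seven independent columns each required to agree within `2σ_comb` are passed by two
EXACT codes with asymptotic probability above two in three — the per-column level that Šidák's
rule asks for at table level `≈ 0.68` is `0.68^{1/7} ≈ 0.946`, i.e. `z ≈ 2`.  §3 makes the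
calibration a theorem: `c` is `2∫₀^z φ`, continuous and strictly increasing with `c(z) → 1`, so
for EVERY table size `k` and level `L ∈ (0, 1)` the Šidák window `z_k(L) > 0` with
`c(z_k(L))^k = L` exists and is unique (**`existsUnique_sidak_z`**), and it is monotone in the
data (`sidak_z_strictMono`): from `c(1)⁷ < 0.075` (that file) and `c(2)⁷ > 2/3` (this one),
`1 < z_7(L) < 2` for every `L ∈ [0.075, 2/3]`.  NEW WORK of the cell
(textbook; our formalisation); no definition; nothing cited as a fact.  Printed counterparts NAMED
ONLY: the Mills ratio / Gordon's inequality (1941); nothing cited.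

## Content

* `hasDerivAt_neg_exp_neg_sq_half`, **`integral_Ioi_mul_exp_neg_sq_half`**
  (`∫_{(z,∞)} x e^{−x²/2} = e^{−z²/2}`, `z ≥ 0`);
* **`gaussianReal_real_Ioi_le`** — `N(0,1)((z, ∞)) ≤ φ(z)/z` (`z > 0`);
* `gaussianReal_real_Iio_neg_eq` — symmetry `N(0,1)((−∞, −z)) = N(0,1)((z, ∞))`;
* **`gaussianReal_real_Icc_ge`** — `1 − 2φ(z)/z ≤ N(0,1)([−z, z])`;
* `gaussianPDFReal_two_lt`, **`gaussianReal_real_Icc_two_ge`**,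
  **`gaussianReal_real_Icc_two_pow_seven_gt`**;
* `gaussianReal_real_Icc_eq_two_mul_primitive` (`c(z) = 2∫₀^z φ`), `strictMono_primitive_…`,
  **`tendsto_gaussianReal_real_Icc_symm_atTop`** (`c(z) → 1`), **`existsUnique_sidak_z`** (for
  every `k ≠ 0` and level `L ∈ (0,1)` a unique `z > 0` with `c(z)^k = L`), `sidak_z_strictMono`.

NOT CLAIMED: the sharp value of `c(2)`; the exact Šidák `z` for a given table level (an inverse
Gaussian evaluation); dependent columns; any number of ours.
-/

noncomputable section

namespace Summit.Ventures.LatticeQCDFlow.Scoring.CardConsistency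

open MeasureTheory ProbabilityTheory Filter Set
open scoped Topology ENNReal NNReal

/-! ## §1 The Mills-ratio tail bound -/

section Mills

/-- `d/dx (−e^{−x²/2}) = x e^{−x²/2}`. [folklore] -/
theorem hasDerivAt_neg_exp_neg_sq_half (x : ℝ) :
    HasDerivAt (fun y : ℝ => -Real.exp (-(y ^ 2 / 2))) (x * Real.exp (-(x ^ 2 / 2))) x := by
  have h1 : HasDerivAt (fun y : ℝ => -(y ^ 2 / 2)) (-x) x := by
    have h0 := ((hasDerivAt_pow 2 x).div_const 2).fun_neg
    refine h0.congr_deriv ?_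
    norm_num
  have h2 := h1.exp.fun_neg
  refine h2.congr_deriv ?_
  ring

/-- **`∫_{(z,∞)} x e^{−x²/2} dx = e^{−z²/2}`** for `z ≥ 0` (FTC on a half-line; the integrand is
non-negative there). [folklore] -/
theorem integral_Ioi_mul_exp_neg_sq_half {z : ℝ} (hz : 0 ≤ z) :
    ∫ x in Ioi z, x * Real.exp (-(x ^ 2 / 2)) = Real.exp (-(z ^ 2 / 2)) := by
  have hlim : Tendsto (fun y : ℝ => -Real.exp (-(y ^ 2 / 2))) atTop (𝓝 0) := by
    rw [← neg_zero]
    refine Tendsto.neg ?_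
    refine Real.tendsto_exp_atBot.comp ?_
    refine tendsto_neg_atTop_atBot.comp ?_
    refine Tendsto.atTop_div_const (by norm_num) ?_
    exact tendsto_pow_atTop two_ne_zero
  rw [integral_Ioi_of_hasDerivAt_of_nonneg' (fun x _ => hasDerivAt_neg_exp_neg_sq_half x)
    (fun x hx => mul_nonneg (hz.trans (le_of_lt hx)) (Real.exp_nonneg _)) hlim]
  ring

/-- The integrand `x e^{−x²/2}` is integrable on `(z, ∞)` for `z ≥ 0`. [folklore] -/
theorem integrableOn_Ioi_mul_exp_neg_sq_half {z : ℝ} (hz : 0 ≤ z) :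
    IntegrableOn (fun x : ℝ => x * Real.exp (-(x ^ 2 / 2))) (Ioi z) := by
  have hlim : Tendsto (fun y : ℝ => -Real.exp (-(y ^ 2 / 2))) atTop (𝓝 0) := by
    rw [← neg_zero]
    refine Tendsto.neg ?_
    refine Real.tendsto_exp_atBot.comp ?_
    refine tendsto_neg_atTop_atBot.comp ?_
    refine Tendsto.atTop_div_const (by norm_num) ?_
    exact tendsto_pow_atTop two_ne_zero
  exact integrableOn_Ioi_deriv_of_nonneg' (fun x _ => hasDerivAt_neg_exp_neg_sq_half x)
    (fun x hx => mul_nonneg (hz.trans (le_of_lt hx)) (Real.exp_nonneg _)) hlim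

/-- The standard normal density in the form `φ(x) = (√(2π))⁻¹ e^{−x²/2}`. -/
theorem gaussianPDFReal_std_eq (x : ℝ) :
    gaussianPDFReal 0 1 x = (Real.sqrt (2 * Real.pi))⁻¹ * Real.exp (-(x ^ 2 / 2)) := by
  rw [gaussianPDFReal_def]
  simp only [NNReal.coe_one, mul_one, sub_zero]
  congr 1
  rw [neg_div]

/-- **Mills' tail bound**: `N(0,1)((z, ∞)) ≤ φ(z)/z` for `z > 0`. [ours] -/
theorem gaussianReal_real_Ioi_le {z : ℝ} (hz : 0 < z) :
    (gaussianReal 0 1).real (Ioi z) ≤ gaussianPDFReal 0 1 z / z := by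
  rw [measureReal_def, gaussianReal_apply_eq_integral 0 one_ne_zero,
    ENNReal.toReal_ofReal (setIntegral_nonneg measurableSet_Ioi
      fun x _ => gaussianPDFReal_nonneg _ _ _)]
  have hC : 0 ≤ (Real.sqrt (2 * Real.pi))⁻¹ := inv_nonneg.2 (Real.sqrt_nonneg _)
  -- `φ(x) ≤ (x/z) φ(x)` on `(z, ∞)`
  have hint : IntegrableOn (fun x : ℝ =>
      (Real.sqrt (2 * Real.pi))⁻¹ / z * (x * Real.exp (-(x ^ 2 / 2)))) (Ioi z) :=
    (integrableOn_Ioi_mul_exp_neg_sq_half hz.le).const_mul _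
  calc ∫ x in Ioi z, gaussianPDFReal 0 1 x
      ≤ ∫ x in Ioi z, (Real.sqrt (2 * Real.pi))⁻¹ / z * (x * Real.exp (-(x ^ 2 / 2))) := by
        refine setIntegral_mono_on (integrable_gaussianPDFReal 0 1).integrableOn hint
          measurableSet_Ioi fun x hx => ?_
        rw [gaussianPDFReal_std_eq]
        have hxz : 1 ≤ x / z := by rw [le_div_iff₀ hz, one_mul]; exact le_of_lt hx
        have hE : 0 ≤ Real.exp (-(x ^ 2 / 2)) := Real.exp_nonneg _
        calc (Real.sqrt (2 * Real.pi))⁻¹ * Real.exp (-(x ^ 2 / 2))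
            = (Real.sqrt (2 * Real.pi))⁻¹ * Real.exp (-(x ^ 2 / 2)) * 1 := (mul_one _).symm
          _ ≤ (Real.sqrt (2 * Real.pi))⁻¹ * Real.exp (-(x ^ 2 / 2)) * (x / z) :=
              mul_le_mul_of_nonneg_left hxz (mul_nonneg hC hE)
          _ = (Real.sqrt (2 * Real.pi))⁻¹ / z * (x * Real.exp (-(x ^ 2 / 2))) := by
              field_simp
    _ = (Real.sqrt (2 * Real.pi))⁻¹ / z * Real.exp (-(z ^ 2 / 2)) := by
        rw [integral_const_mul, integral_Ioi_mul_exp_neg_sq_half hz.le]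
    _ = gaussianPDFReal 0 1 z / z := by
        rw [gaussianPDFReal_std_eq]
        field_simp

/-- **Symmetry**: `N(0,1)((−∞, −z)) = N(0,1)((z, ∞))`. [folklore] -/
theorem gaussianReal_real_Iio_neg_eq (z : ℝ) :
    (gaussianReal 0 1).real (Iio (-z)) = (gaussianReal 0 1).real (Ioi z) := by
  have h := gaussianReal_map_neg (μ := 0) (v := 1)
  rw [neg_zero] at h
  have h2 : (gaussianReal 0 1) (Iio (-z)) = ((gaussianReal 0 1).map (fun x : ℝ => -x)) (Iio (-z)) := by
    rw [h]
  rw [measureReal_def, measureReal_def, h2, Measure.map_apply measurable_neg measurableSet_Iio]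
  congr 2
  ext x
  simp

/-- **Two-sided**: `1 − 2φ(z)/z ≤ N(0,1)([−z, z])` for `z > 0`. [ours] -/
theorem gaussianReal_real_Icc_ge {z : ℝ} (hz : 0 < z) :
    1 - 2 * (gaussianPDFReal 0 1 z / z) ≤ (gaussianReal 0 1).real (Icc (-z) z) := by
  have hcompl : (gaussianReal 0 1).real (Icc (-z) z)ᶜ = 1 - (gaussianReal 0 1).real (Icc (-z) z) :=
    probReal_compl_eq_one_sub measurableSet_Icc
  have hU : (gaussianReal 0 1).real (Icc (-z) z)ᶜ
      ≤ (gaussianReal 0 1).real (Iio (-z)) + (gaussianReal 0 1).real (Ioi z) := by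
    calc (gaussianReal 0 1).real (Icc (-z) z)ᶜ ≤ (gaussianReal 0 1).real (Iio (-z) ∪ Ioi z) :=
          measureReal_mono fun x hx => by
            simp only [mem_compl_iff, mem_Icc, not_and_or, not_le] at hx
            rcases hx with h | h
            · exact Or.inl h
            · exact Or.inr h
      _ ≤ _ := measureReal_union_le _ _
  rw [gaussianReal_real_Iio_neg_eq] at hU
  have ht := gaussianReal_real_Ioi_le hz
  linarith

end Mills

/-! ## §2 The numbers at `z = 2` -/

section TwoSigma

/-- `φ(2) = e^{−2}/√(2π) < 0.02705 · 2 = 0.0541`. [ours] -/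
theorem gaussianPDFReal_two_lt : gaussianPDFReal 0 1 2 < 0.0541 := by
  rw [gaussianPDFReal_std_eq]
  -- `e^{−2} < 0.13534`
  have he : Real.exp (-((2 : ℝ) ^ 2 / 2)) < 0.13534 := by
    have h1 : (2.7182818283 : ℝ) < Real.exp 1 := Real.exp_one_gt_d9
    have h2 : Real.exp (-((2 : ℝ) ^ 2 / 2)) = (Real.exp 1 * Real.exp 1)⁻¹ := by
      rw [← Real.exp_add, ← Real.exp_neg]; norm_num
    rw [h2, inv_lt_comm₀ (by positivity) (by norm_num)]
    nlinarith [Real.exp_pos 1]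
  -- `√(2π) > 2.5066`
  have hs : (2.5066 : ℝ) < Real.sqrt (2 * Real.pi) := by
    refine Real.lt_sqrt_of_sq_lt ?_
    have := Real.pi_gt_d6
    nlinarith
  have hinv : (Real.sqrt (2 * Real.pi))⁻¹ < (2.5066 : ℝ)⁻¹ := by
    rw [inv_lt_inv₀ (by positivity) (by norm_num)]
    exact hs
  calc (Real.sqrt (2 * Real.pi))⁻¹ * Real.exp (-((2 : ℝ) ^ 2 / 2))
      < (2.5066 : ℝ)⁻¹ * 0.13534 :=
        mul_lt_mul'' hinv he (inv_nonneg.2 (Real.sqrt_nonneg _)) (Real.exp_nonneg _)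
    _ < 0.0541 := by norm_num

/-- **`N(0,1)([−2, 2]) ≥ 0.9459`** (true value `≈ 0.9545`). [ours] -/
theorem gaussianReal_real_Icc_two_ge : (0.9459 : ℝ) ≤ (gaussianReal 0 1).real (Icc (-2) 2) := by
  have h := gaussianReal_real_Icc_ge (z := 2) two_pos
  have hφ := gaussianPDFReal_two_lt
  linarith

/-- **Seven independent `2σ` columns: `N(0,1)([−2, 2])⁷ > 2/3`** (true value `≈ 0.722`). [ours] -/
theorem gaussianReal_real_Icc_two_pow_seven_gt :
    (2 : ℝ) / 3 < (gaussianReal 0 1).real (Icc (-2) 2) ^ 7 := by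
  calc (2 : ℝ) / 3 < (0.9459 : ℝ) ^ 7 := by norm_num
    _ ≤ (gaussianReal 0 1).real (Icc (-2) 2) ^ 7 :=
        pow_le_pow_left₀ (by norm_num) gaussianReal_real_Icc_two_ge 7

end TwoSigma

/-! ## §3 The Šidák `z` exists and is unique for every table size and level -/

section SidakZ

/-- The standard normal density is continuous. [folklore] -/
theorem continuous_gaussianPDFReal_std : Continuous (gaussianPDFReal 0 1) := by
  rw [gaussianPDFReal_def]
  fun_prop

/-- The half-line primitive `F(z) = ∫₀^z φ` has derivative `φ(z)`. [folklore] -/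
theorem hasDerivAt_primitive_gaussianPDFReal (z : ℝ) :
    HasDerivAt (fun u : ℝ => ∫ x in (0 : ℝ)..u, gaussianPDFReal 0 1 x) (gaussianPDFReal 0 1 z) z :=
  (continuous_gaussianPDFReal_std.integral_hasStrictDerivAt 0 z).hasDerivAt

/-- `F` is strictly increasing on `ℝ` (its derivative `φ` is positive). [folklore] -/
theorem strictMono_primitive_gaussianPDFReal :
    StrictMono (fun u : ℝ => ∫ x in (0 : ℝ)..u, gaussianPDFReal 0 1 x) := by
  refine strictMono_of_deriv_pos fun z => ?_
  rw [(hasDerivAt_primitive_gaussianPDFReal z).deriv]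
  exact gaussianPDFReal_pos 0 1 z one_ne_zero

/-- `F` is continuous. [folklore] -/
theorem continuous_primitive_gaussianPDFReal :
    Continuous (fun u : ℝ => ∫ x in (0 : ℝ)..u, gaussianPDFReal 0 1 x) :=
  continuous_iff_continuousAt.2 fun z => (hasDerivAt_primitive_gaussianPDFReal z).continuousAt

/-- **`c(z) = 2 F(z)`**: `N(0,1)([−z, z]) = 2 ∫₀^z φ` for `z ≥ 0` (symmetry of `φ`). [folklore] -/
theorem gaussianReal_real_Icc_eq_two_mul_primitive {z : ℝ} (hz : 0 ≤ z) :
    (gaussianReal 0 1).real (Icc (-z) z) = 2 * ∫ x in (0 : ℝ)..z, gaussianPDFReal 0 1 x := by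
  rw [measureReal_def, gaussianReal_apply_eq_integral 0 one_ne_zero,
    ENNReal.toReal_ofReal (setIntegral_nonneg measurableSet_Icc
      fun x _ => gaussianPDFReal_nonneg _ _ _),
    integral_Icc_eq_integral_Ioc, ← intervalIntegral.integral_of_le (by linarith),
    ← intervalIntegral.integral_add_adjacent_intervals (b := 0)
      (continuous_gaussianPDFReal_std.intervalIntegrable _ _)
      (continuous_gaussianPDFReal_std.intervalIntegrable _ _)]
  have hsymm : ∫ x in (-z)..(0 : ℝ), gaussianPDFReal 0 1 x
      = ∫ x in (0 : ℝ)..z, gaussianPDFReal 0 1 x := by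
    have h := intervalIntegral.integral_comp_neg (a := (0 : ℝ)) (b := z)
      (f := gaussianPDFReal 0 1)
    rw [neg_zero] at h
    rw [← h]
    refine intervalIntegral.integral_congr fun x _ => ?_
    simp only [gaussianPDFReal_std_eq, even_two.neg_pow]
  rw [hsymm]
  ring

/-- **`c(z) → 1` as `z → ∞`** (from the Mills bound). [folklore] -/
theorem tendsto_gaussianReal_real_Icc_symm_atTop :
    Tendsto (fun z : ℝ => (gaussianReal 0 1).real (Icc (-z) z)) atTop (𝓝 1) := by
  -- `φ(z)/z ≤ (√(2π))⁻¹/z → 0`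
  have hφ : Tendsto (fun z : ℝ => gaussianPDFReal 0 1 z / z) atTop (𝓝 0) := by
    have hup : Tendsto (fun z : ℝ => (Real.sqrt (2 * Real.pi))⁻¹ * z⁻¹) atTop (𝓝 0) := by
      rw [← mul_zero (Real.sqrt (2 * Real.pi))⁻¹]
      exact tendsto_inv_atTop_zero.const_mul _
    refine tendsto_of_tendsto_of_tendsto_of_le_of_le' tendsto_const_nhds hup ?_ ?_
    · filter_upwards [eventually_gt_atTop 0] with z hz
      exact div_nonneg (gaussianPDFReal_nonneg _ _ _) hz.le
    · filter_upwards [eventually_gt_atTop 0] with z hz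
      rw [div_eq_mul_inv]
      refine mul_le_mul_of_nonneg_right ?_ (inv_nonneg.2 hz.le)
      rw [gaussianPDFReal_std_eq]
      calc (Real.sqrt (2 * Real.pi))⁻¹ * Real.exp (-(z ^ 2 / 2))
          ≤ (Real.sqrt (2 * Real.pi))⁻¹ * 1 := by
            refine mul_le_mul_of_nonneg_left ?_ (inv_nonneg.2 (Real.sqrt_nonneg _))
            rw [Real.exp_le_one_iff]
            have := sq_nonneg z
            linarith
        _ = _ := mul_one _
  have hlow : Tendsto (fun z : ℝ => 1 - 2 * (gaussianPDFReal 0 1 z / z)) atTop (𝓝 1) := by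
    have := (hφ.const_mul 2).const_sub 1
    simpa using this
  refine tendsto_of_tendsto_of_tendsto_of_le_of_le' hlow tendsto_const_nhds ?_
    (Eventually.of_forall fun z => measureReal_le_one)
  filter_upwards [eventually_gt_atTop 0] with z hz
  exact gaussianReal_real_Icc_ge hz

/-- **THE ŠIDÁK `z` EXISTS AND IS UNIQUE.**  For every table size `k ≠ 0` and every table level
`L ∈ (0, 1)` there is exactly one `z > 0` with `N(0,1)([−z, z])^k = L`: the per-column window at
which `k` independent, asymptotically calibrated columns agree simultaneously with asymptotic
probability exactly `L`. [ours] -/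
theorem existsUnique_sidak_z {L : ℝ} (hL0 : 0 < L) (hL1 : L < 1) {k : ℕ} (hk : k ≠ 0) :
    ∃! z : ℝ, 0 < z ∧ (gaussianReal 0 1).real (Icc (-z) z) ^ k = L := by
  set F : ℝ → ℝ := fun u => ∫ x in (0 : ℝ)..u, gaussianPDFReal 0 1 x with hF
  set ℓ : ℝ := L ^ ((k : ℝ)⁻¹) with hℓ
  have hℓ0 : 0 < ℓ := Real.rpow_pos_of_pos hL0 _
  have hℓ1 : ℓ < 1 := Real.rpow_lt_one hL0.le hL1 (by positivity)
  have hℓk : ℓ ^ k = L := Real.rpow_inv_natCast_pow hL0.le hk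
  have hF0 : F 0 = 0 := intervalIntegral.integral_same
  -- a point where `c` exceeds `ℓ`
  obtain ⟨Z, hZpos, hZ⟩ : ∃ Z : ℝ, 0 < Z ∧ ℓ < (gaussianReal 0 1).real (Icc (-Z) Z) := by
    have h := (tendsto_gaussianReal_real_Icc_symm_atTop.eventually (lt_mem_nhds hℓ1)).and
      (eventually_gt_atTop 0)
    obtain ⟨Z, hZ1, hZ2⟩ := h.exists
    exact ⟨Z, hZ2, hZ1⟩
  rw [gaussianReal_real_Icc_eq_two_mul_primitive hZpos.le] at hZ
  -- intermediate value on `[0, Z]` for `F`, target `ℓ/2`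
  have hIVT : ℓ / 2 ∈ F '' Icc 0 Z := by
    have hsub := intermediate_value_Icc hZpos.le
      (continuous_primitive_gaussianPDFReal.continuousOn (s := Icc 0 Z))
    refine hsub ⟨?_, ?_⟩
    · show F 0 ≤ ℓ / 2
      rw [hF0]; linarith
    · show ℓ / 2 ≤ F Z
      linarith
  obtain ⟨z, hzI, hz⟩ := hIVT
  have hzpos : 0 < z := by
    rcases hzI.1.eq_or_lt with h | h
    · exfalso
      rw [← h, hF0] at hz
      linarith
    · exact h
  refine ⟨z, ⟨hzpos, ?_⟩, ?_⟩
  · rw [gaussianReal_real_Icc_eq_two_mul_primitive hzpos.le, show (2 : ℝ) * F z = ℓ by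
      rw [hz]; ring, hℓk]
  · rintro z' ⟨hz'pos, hz'⟩
    have hc0 : 0 ≤ (gaussianReal 0 1).real (Icc (-z') z') := measureReal_nonneg
    have hceq : (gaussianReal 0 1).real (Icc (-z') z') = ℓ := by
      rw [← hℓk] at hz'
      exact (pow_left_inj₀ hc0 hℓ0.le hk).1 hz'
    rw [gaussianReal_real_Icc_eq_two_mul_primitive hz'pos.le] at hceq
    have hFz' : F z' = F z := by
      show (∫ x in (0 : ℝ)..z', gaussianPDFReal 0 1 x) = F z
      rw [hz]; linarith
    exact strictMono_primitive_gaussianPDFReal.injective hFz'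

/-- **Monotonicity of the calibration**: if `c(z₀)^k < L = c(z)^k` then `z₀ < z`, and if
`c(z)^k = L < c(z₁)^k` then `z < z₁` (`z, z₀, z₁ ≥ 0`, any `k`).  With this file's `c(2)⁷ > 2/3` and
`Scoring/SimultaneousAgreementIndependentColumns`' `c(1)⁷ < 0.075`, the Šidák window for a
seven-coupling table at level `2/3` lies in `(1, 2)`. [ours] -/
theorem sidak_z_strictMono {z z' : ℝ} (hz : 0 ≤ z) (hz' : 0 ≤ z') {k : ℕ}
    (h : (gaussianReal 0 1).real (Icc (-z) z) ^ k < (gaussianReal 0 1).real (Icc (-z') z') ^ k) :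
    z < z' := by
  have hc : (gaussianReal 0 1).real (Icc (-z) z) < (gaussianReal 0 1).real (Icc (-z') z') :=
    lt_of_pow_lt_pow_left₀ k measureReal_nonneg h
  rw [gaussianReal_real_Icc_eq_two_mul_primitive hz,
    gaussianReal_real_Icc_eq_two_mul_primitive hz'] at hc
  exact strictMono_primitive_gaussianPDFReal.lt_iff_lt.1 (by linarith)

end SidakZ

end Summit.Ventures.LatticeQCDFlow.Scoring.CardConsistency

end
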